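import Mathlib
import HarnessLib
import Literature.Analysis.FluidPDE.SuitableWeak
import Literature.Analysis.FluidPDE.SelfSimilar
import Literature.Analysis.FluidPDE.LocalTypeI
import Literature.Analysis.FluidPDE.LocalTypeIScaling
import Literature.Analysis.FluidPDE.CKN1982Setting
import Summits.NavierStokesRegularity.NavierStokesRegularity.Theorems.TypeIQuarterGateScarEnvelopeTypeIBudgetTools

/-!
# Door S31 `QuietScarPocketDoor`, K-piece PK1 `scarPocketZoom_holds` — STUB F2″
# `isBackwardSingularPoint_nsRescale_of_not_bounded`: an apex that is not locally bounded is a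
# backward singular vertex of every Navier–Stokes zoom

Width-seat file (prover ns-sz-p1 g4 under LEAD ns-s30-p1; PK1 skeleton `PK1-Skeleton.lean` sha16
e9d92a063109a968, stub F2″ verbatim).  If `u` is continuous on the open cylinder `(−1,0) × B(0,1)` and
is NOT bounded on any backward parabolic neighbourhood `(−ϱ², 0) × B(0, ϱ)` of the apex `(0,0)`, then
for every `μ > 0` the zoom `nsRescale μ u = μ u(μ²·, μ·)` has a backward singular point at the origin
(`IsBackwardSingularPoint`, Albritton–Barker's `L^∞` sense): an `L^∞` bound for the zoom on `Q_r(0)`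
is an `L^∞` bound for `u` on `Q_{μr}(0)` (`eLpNorm_top_nsZoom`), hence — `u` being continuous there —
a pointwise bound on `(−ϱ², 0) × B(0, ϱ)`, `ϱ = min(μr, 1)`.

HONEST FRAMING: a by-name helper for item 0056 (`--supports … --as helper`); door S31, PK1, item 0056
`NoTypeII` and the summit are OPEN; nothing here is credited toward them.
-/

noncomputable section

set_option linter.dupNamespace false

namespace Summit.NavierStokesRegularity.NavierStokesRegularity.Theorems.QuietScarPocketDoor

open MeasureTheory Set Function Filter Topology TopologicalSpace Metric
open scoped NNReal ENNReal Topology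
open Literature.Analysis Literature.Analysis.FluidPDE

/-- The Navier–Stokes zoom about the origin in the tree's two spellings:
`nsRescale μ u = μ • stPull (μ²) μ 0 0 u`. -/
theorem nsRescale_eq_smul_stPull (μ : ℝ)
    (u : ℝ → EuclideanSpace ℝ (Fin 3) → EuclideanSpace ℝ (Fin 3)) :
    nsRescale μ u = μ • stPull (μ ^ 2) μ 0 (0 : EuclideanSpace ℝ (Fin 3)) u := by
  funext s y
  rw [nsRescale_apply, smul_stPull_apply, zero_add, zero_add]

/-- **F2″ (PK1 skeleton, verbatim).**  Not locally bounded at the apex ⇒ the apex is a backward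
singular vertex of every zoom `nsRescale μ u`, `μ > 0`. -/
theorem isBackwardSingularPoint_nsRescale_of_not_bounded {μ : ℝ} (hμ : 0 < μ)
    {u : ℝ → EuclideanSpace ℝ (Fin 3) → EuclideanSpace ℝ (Fin 3)}
    (hcont : ContinuousOn (uncurry u) (Ioo (-1 : ℝ) 0 ×ˢ ball (0 : EuclideanSpace ℝ (Fin 3)) 1))
    (h : ¬ ∃ ϱ : ℝ, 0 < ϱ ∧ ∃ B : ℝ, ∀ t : ℝ, -ϱ ^ 2 < t → t < 0 →
      ∀ x ∈ ball (0 : EuclideanSpace ℝ (Fin 3)) ϱ, ‖u t x‖ ≤ B) :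
    IsBackwardSingularPoint (nsRescale μ u) 0 := by
  intro r hr
  by_contra hne
  apply h
  -- the `L^∞` bound for the zoom on `Q_r(0)` is an `L^∞` bound for `u` on `Q_{μ r}(0)`
  have hscale := eLpNorm_top_nsZoom hμ 0 (0 : EuclideanSpace ℝ (Fin 3)) r
    (0 : ℝ × EuclideanSpace ℝ (Fin 3)) u
  have hz : stAffine (μ ^ 2) μ 0 (0 : EuclideanSpace ℝ (Fin 3)) (0 : ℝ × EuclideanSpace ℝ (Fin 3)) = 0 := by
    rw [show (0 : ℝ × EuclideanSpace ℝ (Fin 3)) = ((0 : ℝ), (0 : EuclideanSpace ℝ (Fin 3))) from rfl,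
      stAffine_apply]
    simp
  rw [hz, ← nsRescale_eq_smul_stPull] at hscale
  set S : ℝ≥0∞ := eLpNorm (uncurry u) ∞ (volume.restrict
    (parabolicCylinder (μ * r) (0 : ℝ × EuclideanSpace ℝ (Fin 3)))) with hS
  have hStop : S ≠ ⊤ := by
    intro htop
    apply hne
    rw [hscale, htop, ENNReal.mul_top (ENNReal.ofReal_pos.2 hμ).ne']
  -- the backward neighbourhood `(−ϱ², 0) × B(0, ϱ)`, `ϱ = min (μ r) 1`
  set ϱ : ℝ := min (μ * r) 1 with hϱ
  have hϱ0 : 0 < ϱ := lt_min (mul_pos hμ hr) zero_lt_one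
  have hϱμ : ϱ ≤ μ * r := min_le_left _ _
  have hϱ1 : ϱ ≤ 1 := min_le_right _ _
  have hsub : parabolicCylinder ϱ (0 : ℝ × EuclideanSpace ℝ (Fin 3)) ⊆
      parabolicCylinder (μ * r) (0 : ℝ × EuclideanSpace ℝ (Fin 3)) :=
    parabolicCylinder_mono hϱ0.le hϱμ _
  have hdom : parabolicCylinder ϱ (0 : ℝ × EuclideanSpace ℝ (Fin 3)) ⊆
      Ioo (-1 : ℝ) 0 ×ˢ ball (0 : EuclideanSpace ℝ (Fin 3)) 1 := by
    rintro ⟨t, x⟩ hw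
    rw [mem_parabolicCylinder] at hw
    simp only [Prod.fst_zero, Prod.snd_zero, zero_sub, dist_zero_right] at hw
    have hϱsq : ϱ ^ 2 ≤ 1 := by nlinarith
    refine ⟨⟨by linarith [hw.1.1], hw.1.2⟩, ?_⟩
    rw [mem_ball, dist_zero_right]
    exact hw.2.trans_le hϱ1
  have hcontϱ : ContinuousOn (uncurry u) (parabolicCylinder ϱ (0 : ℝ × EuclideanSpace ℝ (Fin 3))) :=
    hcont.mono hdom
  have hSϱ : eLpNorm (uncurry u) ∞ (volume.restrict
      (parabolicCylinder ϱ (0 : ℝ × EuclideanSpace ℝ (Fin 3)))) ≤ S :=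
    eLpNorm_mono_measure _ (Measure.restrict_mono hsub le_rfl)
  refine ⟨ϱ, hϱ0, S.toReal, fun t ht1 ht2 x hx => ?_⟩
  have hmem : ((t, x) : ℝ × EuclideanSpace ℝ (Fin 3)) ∈
      parabolicCylinder ϱ (0 : ℝ × EuclideanSpace ℝ (Fin 3)) := by
    rw [mem_parabolicCylinder]
    simp only [Prod.fst_zero, Prod.snd_zero, zero_sub, dist_zero_right]
    rw [mem_ball, dist_zero_right] at hx
    exact ⟨⟨ht1, ht2⟩, hx⟩
  have h1 : ‖uncurry u (t, x)‖ₑ ≤ S :=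
    (Summit.NavierStokesRegularity.NavierStokesRegularity.Cruxes.ScarEnvelopeTypeI.SliceBudget.enorm_le_eLpNorm_top_of_continuousOn
      (isOpen_parabolicCylinder _ _) hcontϱ hmem).trans hSϱ
  have h2 : ‖u t x‖ₑ ≤ S := h1
  rw [← ofReal_norm] at h2
  exact (ENNReal.ofReal_le_iff_le_toReal hStop).1 h2

end Summit.NavierStokesRegularity.NavierStokesRegularity.Theorems.QuietScarPocketDoor

end
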